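import Literature.NumberTheory.EllipticCurves.KuriharaNumberKimShaLength
import HarnessLib

/-!
# Kim 2026, Thm. 1.8 (6) in analytic rank `0`, BEYOND THE UNIT CASE: a Kurihara number non-zero
# modulo `p^k` at a level `n ∈ 𝒩_k` gives the LOWER BOUND `length Ш(E/ℚ)[p^∞] ≥ ord_p(L(E,1)/Ω⁺_E) − (k − 1)`
# at ANY reduction type (named fact)

Topic `NumberTheory/EllipticCurves`, sub-directory `Kim2026` (author–year; namespace = path,
`Literature.NumberTheory.EllipticCurves.Kim2026`). ONE named fact (`def … : Prop`, D-0014), weaker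
than print, and nothing else. It is the rank-ZERO, level-`p^k` twin of two facts already in the tree:

* `Kim2022_rankZero_padicValRat_sha_of_kuriharaNumber_ne_zero_of_maninConstant` (file
  `KuriharaNumberKimShaLength`, harvest seat 2 gen 5): clause (6) as an EQUALITY from a UNIT Kurihara
  number `δ̃_n^{(1)} ≠ 0` (`∂^{(∞)}(δ̃) = 0`) — the case `k = 1` below, where the present inequality and
  the certificate-free upper bound `Kim2026.rankZero_padicValNat_sha_le_of_maninConstant` (file
  `Kim2026/ShaLengthRankZeroUpperBound`) together return that equality;
* `Kim2022_rankOne_padicValNat_sha_le_one_of_kuriharaNumber_levelTwo_ne_zero_of_maninConstant`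
  (same file, harvest seat 2 gen 6): the analytic-rank-ONE reading of a Kurihara number non-zero
  modulo `p²` at a Kolyvagin prime of level `2` (`∂^{(1)}(δ̃) ≤ 1`) — whose three-line derivation from
  §1.5.1 is repeated here word for word in rank `0` and at a general level `k`.

Written for the residual cell `b2b-bsdres` (team n1011, OWNERS row T-N10K; consumer
`Summits/BirchSwinnertonDyer/Rank1Residual/X4/KuriharaLowerHalf.lean`): on a rank-`0` pair with
`p ∣ ∏_ℓ c_ℓ(E)` Kim's Conjecture 1.10 (`∂^{(∞)}(δ̃) = ∑_ℓ ord_p c_ℓ`) predicts that NO unit Kurihara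
number exists, so the unit facts are empty there; the informative certificate is a Kurihara number of
level `k = ord_p ∏ c_ℓ + 1` that is non-zero modulo `p^k`, and what it yields is exactly the LOWER half
`ord_p #Ш_an(E) ≤ ord_p #Ш(E)` of the `p`-part of the Birch–Swinnerton-Dyer formula (the typed
missing input `Typed.MissingLowerBoundAt W p` of the cell's block N10).

## The printed statements (C.-H. Kim, *The structure of Selmer groups and the Iwasawa main conjecture
for elliptic curves*, Amer. J. Math. 148 (2026), no. 1, 79–129 = arXiv:2203.12159; held text = the
arXiv version, store key `paper:arxiv-2203.12159`, page files `pNNNN.txt` cited with line numbers;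
its Thm. 1.9 is Thm. 1.8 of the journal version, statement byte-identical — NUMBERING NOTE of
`KuriharaNumberKimStructure`)

* §1.2.2 (p0005): "`𝒫_k = {ℓ, a prime : (ℓ, Np) = 1, ℓ ≡ 1 (mod p^k), a_ℓ(E) ≡ ℓ + 1 (mod p^k)}` …
  `𝒩_k` the set of square-free products of primes in `𝒫_k` … `I_ℓ = (ℓ − 1, a_ℓ − ℓ − 1)ℤ_p ⊆ ℤ_p` and
  `I_n = ∑_{ℓ∣n} I_ℓ`" — so `I_n ⊆ p^kℤ_p` for `n ∈ 𝒩_k`.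
* §1.4.1 (p0007 L22–30): "Let `p ≥ 5` be a prime and `E` an elliptic curve over `ℚ` such that the
  residual representation `ρ̄` is irreducible and the Manin constant is prime to `p`. … Under our
  assumptions, we have `[r]⁺ ∈ ℤ_(p)`".
* §1.4.3 (p0007 L40–49): "the (mod `I_n`) Kurihara number at `n` is defined by
  `δ̃_n = ∑_{a ∈ (ℤ/nℤ)ˣ} \overline{[a/n]⁺} · ∏_{ℓ∣n} \overline{log_{η_ℓ}(a)} ∈ ℤ_p/I_nℤ_p` … `δ̃_n` is
  well-defined up to `(ℤ_p/I_nℤ_p)ˣ`. When `n ∈ 𝒩_k`, we write `δ̃_n^{(k)} = δ̃_n mod p^k ∈ ℤ/p^kℤ`. When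
  `n = 1`, we have `δ̃_1 = [0]⁺ = L(E,1)/Ω⁺_E ∈ ℤ_(p)`."
* §1.4.4 (p0007 L51–58): "denote by `ν(n)` the number of prime factors of `n` with convention
  `ν(1) = 0`. The vanishing order of `δ̃` is defined by `ord(δ̃) = min{ν(n) : n ∈ 𝒩_1, δ̃_n ≠ 0}`."
* §1.5.1 (p0007 L70–82): "Denote by `∂^{(0)}(δ̃)` … the `p`-adic valuation of `δ̃_1` … For `i ∈ ℤ_{>0}`,
  we also define … `∂^{(i)}(δ̃) = min{j : δ̃_n ∈ p^j ℤ_p/I_nℤ_p for every n ∈ 𝒩_1 with ν(n) = i}` …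
  We also write `∂^{(∞)}(δ̃) = min{∂^{(i)}(δ̃) : 0 ≤ i}`." (the exponent `j` of the `p`-divisibility
  shared by ALL `δ̃_n` with `ν(n) = i`; the same quantity is written with `max` for Kolyvagin systems in
  Def. 2.13, p0014 L64–78: "`∂^{(r)}(κ) = max{j : κ_n ∈ p^j Sel_{rel,n}(ℚ, T/I_nT) for every n ∈ 𝒩_1
  with ν(n) = r}`").
* **Theorem 1.9** (p0007 L88–p0008 L9): "Let `E` be an elliptic curve over `ℚ` and `p ≥ 5` a prime
  such that `ρ̄` is surjective and the Manin constant is prime to `p`. If `ord(δ̃) < ∞`, then … If we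
  further assume the finiteness of `Ш(E/ℚ)[p^∞]`, then we have … (6)
  `length_{ℤ_p}(Ш(E/ℚ)[p^∞]) = ∂^{(ord(δ̃))}(δ̃) − ∂^{(∞)}(δ̃)`."
* §1.5.2 (p0008 L13–16): "We are able to obtain an approximate structural upper bound of
  `Sel(ℚ, E[p^∞])` in practice since each `i`-th higher Fitting ideal can be approximated by computing
  the valuations of `δ̃_n`'s with fixed `ν(n) = i`."
* Conjecture 1.10 (p0008 L25–29): "`∂^{(∞)}(δ̃) = ∑_{ℓ∣N} ord_p(c_ℓ)`" — OPEN; not typed, not used.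
* §1.3.5 (p0006 L99–100): "the Manin constant assumption is needed only when `E` has additive
  reduction at `p`." Theorem 1.9 carries NO hypothesis on the reduction type at `p` (the additive
  case is treated inside the proof: Prop. 3.2, Lemma 3.10, PDF pp. 15, 17 — see the section docstring
  "The rank-zero clause at ANY prime `p ≥ 5`" of `KuriharaNumberKimShaLength`).

## The fact below (weaker than print) and its three-line derivation

Let `k ≥ 1`, `n ∈ 𝒩_k` with `ν(n) = i`, and suppose `δ̃_n^{(k)} ≠ 0` in `ℤ/p^kℤ`. (a) Since
`δ̃_n^{(k)} = δ̃_n mod p^k` (§1.4.3, `I_n ⊆ p^kℤ_p` by §1.2.2), `δ̃_n ∉ p^k ℤ_p/I_nℤ_p`; hence the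
exponent `j = ∂^{(i)}(δ̃)` of §1.5.1 — the `p`-divisibility shared by ALL `δ̃_{n'}` with `ν(n') = i`,
`n' ∈ 𝒩_1 ⊇ 𝒩_k` — satisfies `∂^{(i)}(δ̃) ≤ k − 1` (for `i = 0`, i.e. `n = 1`, the same holds with
`∂^{(0)}(δ̃) = ord_p δ̃_1`), and therefore `∂^{(∞)}(δ̃) = min_{i' ≥ 0} ∂^{(i')}(δ̃) ≤ k − 1`. (b) In analytic
rank `0` (`L(E,1) ≠ 0`): `δ̃_1 = [0]⁺ = L(E,1)/Ω⁺_E ≠ 0`, so `ord(δ̃) = ν(1) = 0 < ∞` (§1.4.3–1.4.4) and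
`∂^{(ord(δ̃))}(δ̃) = ∂^{(0)}(δ̃) = ord_p(L(E,1)/Ω⁺_E)` (§1.5.1). (c) Clause (6) of Theorem 1.9 (Ш finite):
`length_{ℤ_p} Ш(E/ℚ)[p^∞] = ∂^{(0)}(δ̃) − ∂^{(∞)}(δ̃) ≥ ord_p(L(E,1)/Ω⁺_E) − (k − 1)`, i.e.
`ord_p(L(E,1)/Ω⁺_E) ≤ ord_p #Ш(E/ℚ)(p) + (k − 1)`. This INEQUALITY is the fact below. For `k = 1` it is
the lower half of the unit fact's equality; Kim's §1.5.2 sentence quoted above is the informal form of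
step (a).

HYPOTHESES AS TYPED — IDENTICAL, binder for binder, to
`Kim2022_rankZero_padicValRat_sha_of_kuriharaNumber_ne_zero_of_maninConstant` with the level `1`
replaced by `k` (each at least as strong as print; the fact is weaker than print, never stronger):
`W/ℚ` globally minimal; `5 ≤ p`; `ρ̄_{E,p}` onto (`HasSurjectiveModNGaloisRep p`); `L(E,1) ≠ 0`;
`Finite W.sha` (for "the finiteness of `Ш(E/ℚ)[p^∞]`"); Kim's hypothesis (ii) carried EXPLICITLY by a
modular parametrisation datum `D : ModularParametrizationData W N` with `p ∤ D.maninConstant` (needed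
exactly when `p² ∣ N`, §1.3.5); the period transfer `Ω(W) = u · Ω⁺_{D.f}`, `u ∈ ℚ`, `|u|_p = 1` (Kim's
`[r]⁺ = Re{∞,r}/Ω⁺_E` with the Néron period `Ω⁺_E = W.realPeriodRat` of the minimal model, the tree's
`ratPlusSymbol D.f r = Re{∞,r}/Ω⁺_f`; so `kuriharaNumber D.f (p^k) n ψ = ū · δ̃_n^{(k)}` with `ū` a unit of
`ℤ/p^k` and non-vanishing modulo `p^k` is normalisation-free; the symbols are `p`-integral by §1.4.1);
`1 ≤ k`; `n ∈ 𝒩_k` as `Kato.IsKolyvaginProduct W p k n` (square-free, `ℓ ∤ N_E p`, `ℓ ≡ 1`,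
`a_ℓ ≡ ℓ + 1 (mod p^k)`); the cyclicity flag `#Ẽ(𝔽_ℓ)[p] ≤ p` at every `ℓ ∣ n` of the printed PROOF
(Mazur–Rubin transversality; as in every sibling — weaker fact); surjective discrete logarithms
`ψ_ℓ : (ℤ/ℓ)ˣ ↠ ℤ/p^k` (Kim's `log_{η_ℓ} mod p^k`; another choice rescales `δ` by a unit,
`kuriharaNumber_eq_prod_mul_kuriharaNumber`); the certificate `kuriharaNumber D.f (p^k) n ψ ≠ 0`.
CONCLUSION, in the siblings' currency: there is `q ∈ ℚ` with `L(E,1)/Ω(W) = q` and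
`ord_p q ≤ ord_p #Ш(E/ℚ)(p) + (k − 1)` (`ℕ`-subtraction harmless: `1 ≤ k` is a binder). No `_holds`
(size XL: the whole paper — Mazur–Rubin Kolyvagin systems, Kato's Euler system and explicit
reciprocity law, the case analysis of §5). Flag for the cell referee, as for the level-two sibling:
`Kim-(6)-partial-reading` (step (a) reads §1.5.1's `∂^{(i)}` as the common `p`-divisibility exponent of
the `δ̃_n`, `ν(n) = i` — the reading under which the two accepted sibling facts were filed).

What this fact is NOT: it is not Conjecture 1.10 (no claim that a level-`(ord_p ∏c_ℓ + 1)` certificate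
exists); it is not an upper bound (that is `Kim2026.rankZero_padicValNat_sha_le_of_maninConstant`,
certificate-free); it says nothing at `p = 3` (Theorem 1.9 is printed for `p ≥ 5`; the cell's `p = 3`
analogue is a typed OPEN statement under `Summits/`, team n1011 rows T-a2/T-a3, never a Literature fact).

## References

* C.-H. Kim, Amer. J. Math. 148 (2026) 79–129 = arXiv:2203.12159: §1.2.2, §1.3.5, §1.4.1, §1.4.3–1.4.4,
  §1.5.1–1.5.2, Thm. 1.9 (= journal Thm. 1.8), Conj. 1.10, Def. 2.13. [Kim2022StructureSelmer]
* B. Mazur, K. Rubin, *Kolyvagin systems*, Mem. AMS 799 (2004) (the `∂^{(i)}`, Def. 2.13's source). [MazurRubin2004]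
* M. Kurihara, Münster J. Math. 7 (2014) (higher Stickelberger ideals; §1.5.2's reference). [Kurihara2014]
-/

noncomputable section

open scoped MatrixGroups ModularForm Classical

open CongruenceSubgroup Literature.NumberTheory.EllipticCurves.ModularForms

namespace Literature.NumberTheory.EllipticCurves.Kim2026

/-- **Kim's structure theorem, clause (6), analytic rank `0`, Kurihara number NON-ZERO MODULO `p^k` at
a level `n ∈ 𝒩_k`, ANY reduction type at `p` (additive included): the LOWER bound
`ord_p(L(E,1)/Ω⁺_E) − (k − 1) ≤ length_{ℤ_p} Ш(E/ℚ)[p^∞]`** (C.-H. Kim, Amer. J. Math. 148 (2026)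
79–129, Thm. 1.8 = arXiv:2203.12159v4 **Thm. 1.9 (6)**, with §1.2.2 (`𝒩_k`, `I_n ⊆ p^kℤ_p`), §1.4.1,
§1.4.3–1.4.4 (`δ̃_n^{(k)} = δ̃_n mod p^k`, `δ̃_1 = [0]⁺ = L(E,1)/Ω⁺_E`, `ord(δ̃)`), §1.5.1 (`∂^{(0)}`,
`∂^{(i)}`, `∂^{(∞)} = min_i ∂^{(i)}`), §1.3.5; PDF pp. 5–8; the module docstring has the verbatim
statements, locators and the three-line derivation). Let `W/ℚ` be a globally minimal elliptic curve
and `p ≥ 5` a prime — NO hypothesis on the reduction of `W` at `p` — with `ρ̄_{E,p}` surjective; `D` a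
modular parametrisation datum of `W` at level `N` with `p ∤ D.maninConstant` (Kim's hypothesis (ii),
needed exactly when `p² ∣ N`); `L(E,1) ≠ 0` (so `ord(δ̃) = 0` and `∂^{(0)}(δ̃) = ord_p(L(E,1)/Ω⁺_E)`);
`Ш(E/ℚ)` finite; the period transfer `Ω(W) = u · Ω⁺_{D.f}`, `|u|_p = 1`; `k ≥ 1` and `n ∈ 𝒩_k` a
square-free product of Kolyvagin primes of level `k` (`ℓ ∤ Np`, `ℓ ≡ 1`, `a_ℓ ≡ ℓ + 1 (mod p^k)`) all of
whose prime factors satisfy `#Ẽ(𝔽_ℓ)[p] ≤ p`; `ψ_ℓ : (ℤ/ℓ)ˣ ↠ ℤ/p^k` discrete logarithms; and the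
certificate `kuriharaNumber D.f (p^k) n ψ ≠ 0`, i.e. `δ̃_n^{(k)} ≠ 0` — whence `∂^{(ν(n))}(δ̃) ≤ k − 1`
and `∂^{(∞)}(δ̃) ≤ k − 1`. Then clause (6), `length_{ℤ_p} Ш(E/ℚ)[p^∞] = ∂^{(0)}(δ̃) − ∂^{(∞)}(δ̃)`, gives:
there is `q ∈ ℚ` with `L(E,1)/Ω(W) = q` and `ord_p q ≤ ord_p #Ш(E/ℚ)(p) + (k − 1)`. For `k = 1` this is
the lower half of the unit fact `Kim2022_rankZero_padicValRat_sha_of_kuriharaNumber_ne_zero_of_maninConstant`;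
on a pair with `p ∣ ∏_ℓ c_ℓ` (where, by the expected equality `∂^{(∞)}(δ̃) = ∑_ℓ ord_p c_ℓ` of
§1.5.3, no unit Kurihara number exists) a certificate of level `k ≤ ord_p ∏ c_ℓ + 1` yields the lower half `ord_p #Ш_an ≤ ord_p #Ш` of the
`p`-part of BSD (consumer under `Summits/`). Weaker than print (an inequality read off an equality;
period binder; cyclicity flag; `Finite W.sha`), never stronger. No `_holds` (size XL). **FLAG
`K26-(6)-shallow@t>0` (ARM P D-audit, reader bsd-cited-r10, sheet `D-AUDIT-r10.md` sha16
cfa522325b7b7321 §D.2 F2, adopted STRONGER-THAN-PROOF ⇒ narrow; typer bsd-cited-ty2, 2026-08-26): with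
`t := ord_p #E(ℚ_p)[p^∞]`, the printed proof controls `x_n = u · p^t · δ̃_n ∈ ℤ/p^{k(n)}` (Thm. 3.13,
p0017:L134) only at DEEP levels (§5.4.3, "`k` sufficiently large"), so at a level of depth `k ≤ t` a
non-zero `δ̃_n^{(k)}` does not bound `∂^{(∞)}` through the displayed argument — the clause (6) reading at
such a SHALLOW level rests on §1.5.1's asserted `lim`. Exposure: certificates of depth `k ≤ t` on `t ≥ 1`
rows only (Prop. 3.2: good anomalous `p` with a local `p`-torsion point; additive `p ∈ {5, 7}` on two
congruence classes); every certificate with `k ≥ 1 + t` is covered. PROOF-COVERED TWIN: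
`rankZero_le_padicValNat_sha_of_kuriharaNumber_ne_zero_of_localTorsionTrivial` below (the `(t0)` binder
`#E(ℚ_p)[p] = 1`); this decl is KEPT byte-identical for its importers (bridge `…_of_localTorsionTrivial_of`).**
[cite: Kim2022StructureSelmer, Thm. 1.9 (6) (PDF p. 8), §1.2.2 (PDF p. 5), §1.4.1 and §1.4.3–1.4.4 (PDF p. 7), §1.5.1–1.5.2 (PDF pp. 7–8), §1.3.5 (PDF p. 6)] -/
def rankZero_le_padicValNat_sha_of_kuriharaNumber_ne_zero : Prop :=
  ∀ (W : WeierstrassCurve ℚ) [W.IsElliptic] [W.IsGloballyMinimal] (p : ℕ) [Fact p.Prime],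
    5 ≤ p → W.HasSurjectiveModNGaloisRep p →
    W.entireLFunction 1 ≠ 0 → Finite W.sha →
    ∀ {N : ℕ} [NeZero N] (D : ModularParametrizationData W N),
    ¬ (p : ℤ) ∣ D.maninConstant →
    (∃ u : ℚ, ‖(u : ℚ_[p])‖ = 1 ∧ W.realPeriodRat = u * plusPeriod D.f) →
    ∀ (k n : ℕ) [NeZero n], 1 ≤ k → Kato.IsKolyvaginProduct W p k n →
    (∀ (ℓ : ℕ) [Fact ℓ.Prime], ℓ ∣ n →
      Nat.card {P : ((WeierstrassCurve.integralModelInt W).map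
          (Int.castRingHom (ZMod ℓ))).toAffine.Point // p • P = 0} ≤ p) →
    ∀ ψ : (ℓ : ℕ) → (ZMod ℓ)ˣ →* Multiplicative (ZMod (p ^ k)),
      (∀ ℓ ∈ n.primeFactors, Function.Surjective (ψ ℓ)) →
      kuriharaNumber D.f (p ^ k) n ψ ≠ 0 →
    ∃ q : ℚ, W.entireLFunction 1 / (W.realPeriodRat : ℂ) = (q : ℂ) ∧
      padicValRat p q ≤
        (padicValNat p (Nat.card (AddCommGroup.primaryComponent W.sha p)) : ℤ) + ((k - 1 : ℕ) : ℤ)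

/-- **PROOF-COVERED TWIN of `rankZero_le_padicValNat_sha_of_kuriharaNumber_ne_zero` WITH
`E(ℚ_p)[p] = 0`** (ARM P D-audit, reader bsd-cited-r10 sheet cfa522325b7b7321 §D.2 F2; typer
bsd-cited-ty2, TY-QUEUE 11): the same statement — Kim, Amer. J. Math. 148 (2026), Thm. 1.8 (= arXiv
Thm. 1.9) (6), analytic rank `0`, certificate `δ̃_n^{(k)} ≠ 0` at a cyclic level `n ∈ 𝒩_k`, LOWER
bound `ord_p(L(E,1)/Ω(W)) ≤ ord_p #Ш(E/ℚ)(p) + (k − 1)` — with ONE extra binder after the surjectivity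
binder, `Nat.card {Q : (W.baseChange ℚ_[p]).toAffine.Point // (p : ℕ) • Q = 0} = 1` (`t = 0`, the
shape of the `(t0)` binder of `N11.KimAtThreeRankZeroPUB`; ⟺ `∀ P, (p : ℤ) • P = 0 → P = 0` by
`natCard_localPTorsion_eq_one_iff` in `KuriharaNumberKimShaLengthLocalTorsionTrivial`). Under it
`x_n = u · δ̃_n` exactly (Thm. 3.13) and the printed argument covers every depth `k ≥ 1` (see the flag
on the sibling above). Weaker than print; nothing asserted; no `_holds` (size XL).
[cite: Kim2022StructureSelmer, Thm. 1.9 (6) (PDF p. 8), §1.2.2 (PDF p. 5), §1.4.1 and §1.4.3–1.4.4 (PDF p. 7), §1.5.1–1.5.2 (PDF pp. 7–8), §1.3.5 (PDF p. 6), Prop. 3.2 (PDF p. 15), Thm. 3.13 (PDF p. 17)] -/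
def rankZero_le_padicValNat_sha_of_kuriharaNumber_ne_zero_of_localTorsionTrivial : Prop :=
  ∀ (W : WeierstrassCurve ℚ) [W.IsElliptic] [W.IsGloballyMinimal] (p : ℕ) [Fact p.Prime],
    5 ≤ p → W.HasSurjectiveModNGaloisRep p →
    Nat.card {Q : (W.baseChange ℚ_[p]).toAffine.Point // (p : ℕ) • Q = 0} = 1 →
    W.entireLFunction 1 ≠ 0 → Finite W.sha →
    ∀ {N : ℕ} [NeZero N] (D : ModularParametrizationData W N),
    ¬ (p : ℤ) ∣ D.maninConstant →
    (∃ u : ℚ, ‖(u : ℚ_[p])‖ = 1 ∧ W.realPeriodRat = u * plusPeriod D.f) →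
    ∀ (k n : ℕ) [NeZero n], 1 ≤ k → Kato.IsKolyvaginProduct W p k n →
    (∀ (ℓ : ℕ) [Fact ℓ.Prime], ℓ ∣ n →
      Nat.card {P : ((WeierstrassCurve.integralModelInt W).map
          (Int.castRingHom (ZMod ℓ))).toAffine.Point // p • P = 0} ≤ p) →
    ∀ ψ : (ℓ : ℕ) → (ZMod ℓ)ˣ →* Multiplicative (ZMod (p ^ k)),
      (∀ ℓ ∈ n.primeFactors, Function.Surjective (ψ ℓ)) →
      kuriharaNumber D.f (p ^ k) n ψ ≠ 0 →
    ∃ q : ℚ, W.entireLFunction 1 / (W.realPeriodRat : ℂ) = (q : ℂ) ∧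
      padicValRat p q ≤
        (padicValNat p (Nat.card (AddCommGroup.primaryComponent W.sha p)) : ℤ) + ((k - 1 : ℕ) : ℤ)

/-- Bridge: the literal fact implies its `(t0)` twin (one more hypothesis). Proved.
[cite: Kim2022StructureSelmer, Thm. 1.9 (6) (PDF p. 8)] -/
theorem rankZero_le_padicValNat_sha_of_kuriharaNumber_ne_zero_of_localTorsionTrivial_of
    (h : rankZero_le_padicValNat_sha_of_kuriharaNumber_ne_zero) :
    rankZero_le_padicValNat_sha_of_kuriharaNumber_ne_zero_of_localTorsionTrivial :=
  fun W _ _ p _ hp hsurj _ hL hfin _ _ D hc hu k n _ hk hn hcyc ψ hψ hδ ↦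
    h W p hp hsurj hL hfin D hc hu k n hk hn hcyc ψ hψ hδ

end Literature.NumberTheory.EllipticCurves.Kim2026

end
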